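import Summits.HodgeConjecture.CorCM.MumfordTateRankSixCMPart
import Summits.HodgeConjecture.CorCM.MumfordTateRankSixIsogeny
import Summits.HodgeConjecture.CorCM.MumfordTateRankEqHodgeLieRankAddOne
import Literature.AlgebraicGeometry.Motives.HodgeLieWeightOneBlockIdempotent
import HarnessLib

/-!
# The rungs `dim MT(H¹(X)) ≤ 6`, VI: the Mumford–Tate rank of the CM part — `dim Lie Hg(H¹Z) = dim MT(H¹X) − 4`

COR-CM (cell `pub-hodgecm2`, seat `b27` gen 38, count-neutral lane MT-RANK-SIX-CMPART; theorems only, no definition,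
no named fact; UNCONDITIONAL — nothing here uses or asserts HC_CM).  Sequel of `CorCM/MumfordTateRankSixCMPart` (gen 37:
`Lie Hg(H¹Z) = { M⁻¹ j^* X' t^* | X' ∈ Lie Hg(H¹X) }` for the CM part `Z` of the splitting `X ∼ Y ⊞ Z`) with the abstract
input `HodgeStructure.sub_mul_mem_center_of_block` (`Motives/HodgeLieWeightOneBlockIdempotent`: for the block idempotent
`p = e^*`, `(1 − p) Lie Hg = 𝔷`, i.e. `e^* D = D` on `𝔡 = [Lie Hg, Lie Hg]`).

For a complex abelian variety `X` with `0 < dim X` and `dim [Lie Hg(H¹X), Lie Hg(H¹X)] = 3` (Hodge group of semisimple rank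
one, ANY centre `𝔷`; e.g. `X` NOT of CM type with `dim MT(H¹X) ≤ 6`):

* `finrank_hodgeLie_hodge_one_eq_center_of_block` — along a quasi-retraction `t : X → Z`, `j : Z → X` (`j^* t^* = M`,
  `t^* j^* = M − M p`) whose idempotent `p ∈ End_Hdg(H¹X)` is a block idempotent (`X' − pX' ∈ Lie Hg`, `𝔷 p = 0`, `p ≠ 0`):
  `dim_ℚ Lie Hg(H¹Z) = dim_ℚ 𝔷` — the restriction `X' ↦ M⁻¹ j^* X' t^*` kills `p · Lie Hg ⊇ 𝔡` and is injective on `𝔷`.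
* **`exists_isIsogenous_powSucc_prod_finrank_hodgeLie_of_finrank_derived_eq_three`** — the structure theorem
  `X ∼ B^{m+1} × Z` of `CorCM/MumfordTateRankSixIsogeny` (`B` simple non-CM, `0 < dim B ≤ 2`, `dim End⁰B = (dim B)²`,
  `Z(End⁰B) = ℚ`; `Z` of CM type) WITH the Mumford–Tate rank of the CM part:
  `dim_ℚ Lie Hg(H¹Z) = dim 𝔷 = dim MT(H¹X) − 4`, and `dim MT(H¹Z) = dim MT(H¹X) − 3` when `dim Z > 0`
  (Moonen–Zarhin: `Hg(X) = SL₂ × Hg(Z)` up to isogeny, `Hg(Z)` the central torus);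
  `…_of_mtRank_le_six` — the case `X` not CM, `dim MT(H¹X) ≤ 6`: then `dim Lie Hg(H¹Z) ≤ 2` and `dim MT(H¹Z) ≤ 3`.

The sequel `CorCM/MumfordTateRankSixNondegenerate` concludes: every `X` NOT of CM type with `dim MT(H¹X) ≤ 6` is stably
nondegenerate (the CM part has `dim MT ≤ 3`), hence satisfies the Hodge conjecture with all its powers, unconditionally.

## References

* [MoonenZarhin1999LowDim] B. Moonen, Yu. Zarhin, *Hodge classes on abelian varieties of low dimension*, Math. Ann.
  315 (1999), §2 (2.1)–(2.5) and §3 (3.8).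
* [Deligne1982HodgeCycles] P. Deligne, *Hodge cycles on abelian varieties*, LNM 900 (1982), I §3 Prop. 3.4, 3.6.
* [MumfordAV1970] D. Mumford, *Abelian Varieties* (1970), §19 Thm. 1, Thm. 3 and Cor. 1–2 (pp. 173–174).
* [DeligneMilne1982Tannakian] P. Deligne, J. S. Milne, *Tannakian Categories*, LNM 900 (1982), II Thm. 6.20 (Riemann).
-/

noncomputable section

open scoped TensorProduct
open CategoryTheory CategoryTheory.Limits Module

namespace Summit.HodgeConjecture.CorCM

open Literature.AlgebraicGeometry.Motives
open Literature.AlgebraicGeometry.Motives.AbelianVariety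
open Literature.AlgebraicGeometry.Motives.HodgeStructure
open Literature.AlgebraicGeometry.HodgeTheory
open Literature.AlgebraicGeometry.ComplexMultiplication (bettiRep bettiRep_injective bettiRep_of
  isIsogenous_biproduct_powSucc)
open Literature.AlgebraicGeometry.Milne1999 (IsOfCMType isOfCMType_iff_of_isIsogenous)

variable [HodgeTensorFacts.{0, 0}]

/-! ## §1 The restriction to the CM block has image of dimension `dim 𝔷` -/

/-- **`dim Lie Hg(H¹Z) = dim 𝔷(Lie Hg(H¹X))` along a quasi-retraction onto the block of a block idempotent.**  Let
`t : X → Z`, `j : Z → X` with `j^* t^* = M ≠ 0`, `t^* j^* = M − M p` on `H¹`, where `p ∈ End_Hdg(H¹X)` is an idempotent,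
`p ≠ 0`, `X' − p X' ∈ Lie Hg(H¹X)` for `X' ∈ Lie Hg(H¹X)`, `Z' p = 0` for `Z'` in the centre `𝔷 = Lie Hg ∩ End_Hdg`, and
`dim [Lie Hg(H¹X), Lie Hg(H¹X)] = 3`.  Then `dim_ℚ Lie Hg(H¹Z) = dim_ℚ 𝔷`: by `hodgeLie_hodge_one_eq_image_of_block`,
`Lie Hg(H¹Z)` is the image of `r : X' ↦ M⁻¹ j^* X' t^*`; `r` kills `p X'` (`j^* p = 0`), `X' − p X' ∈ 𝔷`
(`HodgeStructure.sub_mul_mem_center_of_block`), and `r` is injective on `𝔷` (`t^* (j^* Z' t^*) j^* = M² Z'`).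
[cite: MoonenZarhin1999LowDim, §2 and §3 (3.8)] [cite: Deligne1982HodgeCycles, I §3 Prop. 3.4 and 3.6] -/
theorem finrank_hodgeLie_hodge_one_eq_center_of_block {X Z : AbelianVariety ℂ} (hX : IsSmoothProjective X.dim X.X)
    (hZ : IsSmoothProjective Z.dim Z.X) (t : X ⟶ Z) (j : Z ⟶ X) {M : ℕ} (hM : M ≠ 0)
    {p : Module.End ℚ (bettiCohomology X.X 1)}
    (hjt : (bettiCohomology.map j.hom.hom.hom 1).hom ∘ₗ (bettiCohomology.map t.hom.hom.hom 1).hom =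
      (M : ℚ) • LinearMap.id)
    (htj : (bettiCohomology.map t.hom.hom.hom 1).hom ∘ₗ (bettiCohomology.map j.hom.hom.hom 1).hom =
      (M : ℚ) • LinearMap.id - (M : ℚ) • p)
    (hpA : haveI := BettiUniverse.finite hX 1
      p ∈ (BettiUniverse.hodge exists_isReal_hodgeModel_holds hX 1).endAlg)
    (hpp : p * p = p) (hp0 : p ≠ 0)
    (hblk : haveI := BettiUniverse.finite hX 1
      ∀ X' ∈ (BettiUniverse.hodge exists_isReal_hodgeModel_holds hX 1).hodgeLie,
        X' - p * X' ∈ (BettiUniverse.hodge exists_isReal_hodgeModel_holds hX 1).hodgeLie)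
    (hZp : haveI := BettiUniverse.finite hX 1
      ∀ Z' ∈ (BettiUniverse.hodge exists_isReal_hodgeModel_holds hX 1).hodgeLie ⊓
          Subalgebra.toSubmodule (BettiUniverse.hodge exists_isReal_hodgeModel_holds hX 1).endAlg, Z' * p = 0)
    (h3 : haveI := BettiUniverse.finite hX 1
      Module.finrank ℚ ↥(Submodule.span ℚ {B | ∃ X' ∈ (BettiUniverse.hodge exists_isReal_hodgeModel_holds hX 1).hodgeLie,
        ∃ Y ∈ (BettiUniverse.hodge exists_isReal_hodgeModel_holds hX 1).hodgeLie, X' * Y - Y * X' = B}) = 3) :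
    haveI := BettiUniverse.finite hX 1
    haveI := BettiUniverse.finite hZ 1
    Module.finrank ℚ (BettiUniverse.hodge exists_isReal_hodgeModel_holds hZ 1).hodgeLie =
      Module.finrank ℚ ↥((BettiUniverse.hodge exists_isReal_hodgeModel_holds hX 1).hodgeLie ⊓
        Subalgebra.toSubmodule (BettiUniverse.hodge exists_isReal_hodgeModel_holds hX 1).endAlg) := by
  haveI := BettiUniverse.finite hX 1
  haveI := BettiUniverse.finite hZ 1
  have hM' : (M : ℚ) ≠ 0 := Nat.cast_ne_zero.2 hM
  set H := BettiUniverse.hodge exists_isReal_hodgeModel_holds hX 1 with hH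
  set HZ := BettiUniverse.hodge exists_isReal_hodgeModel_holds hZ 1 with hHZ
  obtain ⟨ψ⟩ := BettiUniverse.hodge_isPolarizable exists_isReal_hodgeModel_holds hX 1
  set jH := (bettiCohomology.map j.hom.hom.hom 1).hom with hjH
  set tH := (bettiCohomology.map t.hom.hom.hom 1).hom with htH
  -- the restriction map `r X' = M⁻¹ j^* X' t^*`
  let r : Module.End ℚ (bettiCohomology X.X 1) →ₗ[ℚ] Module.End ℚ (bettiCohomology Z.X 1) :=
    (M : ℚ)⁻¹ • ((LinearMap.llcomp ℚ _ _ _ jH) ∘ₗ (LinearMap.lcomp ℚ _ tH))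
  have hr : ∀ X', r X' = (M : ℚ)⁻¹ • (jH ∘ₗ X' ∘ₗ tH) := fun X' => rfl
  -- `Lie Hg(H¹Z) = r(Lie Hg(H¹X))`
  have himg := hodgeLie_hodge_one_eq_image_of_block hX hZ t j hM hjt htj hblk
  have hmap : HZ.hodgeLie = H.hodgeLie.map r := by
    apply SetLike.coe_injective
    rw [Submodule.map_coe, himg]
    exact Set.image_congr fun X' _ => (hr X').symm
  -- `j^* p = 0`
  have hjp : jH ∘ₗ p = 0 := by
    have h1 : jH ∘ₗ (tH ∘ₗ jH) = (jH ∘ₗ tH) ∘ₗ jH := (LinearMap.comp_assoc _ _ _).symm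
    rw [htj, hjt, LinearMap.comp_sub, LinearMap.comp_smul, LinearMap.comp_smul, LinearMap.comp_id,
      LinearMap.smul_comp, LinearMap.id_comp, sub_eq_self] at h1
    exact (smul_eq_zero.1 h1).resolve_left hM'
  have hrp : ∀ X', r (p * X') = 0 := by
    intro X'
    rw [hr, Module.End.mul_eq_comp, ← LinearMap.comp_assoc, ← LinearMap.comp_assoc X' p jH, hjp, LinearMap.zero_comp,
      LinearMap.zero_comp, smul_zero]
  have hrsub : ∀ X', r (X' - p * X') = r X' := fun X' => by rw [map_sub, hrp, sub_zero]
  -- `r(Lie Hg) = r(𝔷)`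
  have hmapz : H.hodgeLie.map r = (H.hodgeLie ⊓ Subalgebra.toSubmodule H.endAlg).map r := by
    refine le_antisymm ?_ (Submodule.map_mono inf_le_left)
    rintro _ ⟨X', hX', rfl⟩
    exact ⟨X' - p * X', sub_mul_mem_center_of_block H ψ (by simp) h3 hpA hpp hp0 hblk hZp X' hX', hrsub X'⟩
  -- `r` is injective on `𝔷`
  have hinj : ∀ Z' ∈ H.hodgeLie ⊓ Subalgebra.toSubmodule H.endAlg, r Z' = 0 → Z' = 0 := by
    intro Z' hZ' hrZ
    have hZ'𝔥 : Z' ∈ H.hodgeLie := (Submodule.mem_inf.1 hZ').1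
    have hZ'p : Z' * p = 0 := hZp Z' hZ'
    have hpZ' : p * Z' = 0 := by rw [← H.commute_of_mem_hodgeLie hZ'𝔥 ⟨p, hpA⟩]; exact hZ'p
    have h0 : jH ∘ₗ Z' ∘ₗ tH = 0 := by
      rw [hr] at hrZ
      exact (smul_eq_zero.1 hrZ).resolve_left (inv_ne_zero hM')
    -- `t^* (j^* Z' t^*) j^* = (M - M p) Z' (M - M p) = M² Z'`
    have h1 : tH ∘ₗ (jH ∘ₗ Z' ∘ₗ tH) ∘ₗ jH = (tH ∘ₗ jH) * Z' * (tH ∘ₗ jH) := by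
      rw [Module.End.mul_eq_comp, Module.End.mul_eq_comp]
      simp only [LinearMap.comp_assoc]
    rw [h0, LinearMap.zero_comp, LinearMap.comp_zero, htj] at h1
    have h2 : ((M : ℚ) • LinearMap.id - (M : ℚ) • p) * Z' * ((M : ℚ) • LinearMap.id - (M : ℚ) • p) =
        ((M : ℚ) * M) • Z' := by
      rw [← Module.End.one_eq_id]
      simp only [sub_mul, mul_sub, smul_mul_assoc, mul_smul_comm, one_mul, mul_one, hpZ', hZ'p, smul_zero, sub_zero,
        smul_smul]
    rw [h2] at h1
    exact (smul_eq_zero.1 h1.symm).resolve_left (mul_ne_zero hM' hM')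
  -- dimensions
  rw [hmap, hmapz, ← LinearMap.range_domRestrict]
  refine LinearMap.finrank_range_of_inj fun a b hab => ?_
  apply Subtype.ext
  have h := hinj (a.1 - b.1) (Submodule.sub_mem _ a.2 b.2) (by
    rw [map_sub]
    exact sub_eq_zero.2 hab)
  exact sub_eq_zero.1 h

/-! ## §2 The structure theorem with the Mumford–Tate rank of the CM part -/

variable {X : AbelianVariety ℂ} {n : ℕ}

/-- **Semisimple rank one: `X ∼ B^{m+1} × Z` with `dim Lie Hg(H¹Z) = dim MT(H¹X) − 4`.**  For a complex abelian variety `X`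
with `0 < dim X` and `dim [Lie Hg(H¹X), Lie Hg(H¹X)] = 3` (any centre): `X` is isogenous to `B^{m+1} × Z` with `B` SIMPLE,
`0 < dim B ≤ 2`, NOT of CM type, `dim_ℚ End⁰(B) = (dim B)²`, `Z(End⁰ B) = ℚ`, and `Z` OF CM TYPE with
`(m+1) dim B + dim Z = dim X`, `dim Z = 0 ↔ dim MT(H¹X) = 4`; AND the Hodge Lie algebra of the CM part has dimension
`dim_ℚ Lie Hg(H¹Z) = dim_ℚ 𝔷 = dim MT(H¹X) − 4` (`𝔷` the centre of `Lie Hg(H¹X)`), so that `dim MT(H¹Z) = dim MT(H¹X) − 3`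
when `dim Z > 0` — the Lie form of Moonen–Zarhin's `Hg(B^{m+1} × Z) = SL₂ × Hg(Z)`.  PROOF: the splitting
`exists_quasiRetraction_splitting_of_finrank_derived_eq_three`, `exists_isIsogenous_power_of_corner_data` for the
non-CM part, and `finrank_hodgeLie_hodge_one_eq_center_of_block` for the CM part.
[cite: MoonenZarhin1999LowDim, §2 (2.1)–(2.5) and §3 (3.8)] [cite: MumfordAV1970, §19 Thm. 1, Cor. 1–2 (pp. 173–174)]
[cite: Deligne1982HodgeCycles, I §3 Prop. 3.4 and §5 Prop. 5.1] -/
theorem exists_isIsogenous_powSucc_prod_finrank_hodgeLie_of_finrank_derived_eq_three (hX : IsSmoothProjective n X.X)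
    (h0 : 0 < X.dim)
    (h3 : haveI := BettiUniverse.finite hX 1
      Module.finrank ℚ ↥(Submodule.span ℚ {B | ∃ X' ∈ (BettiUniverse.hodge exists_isReal_hodgeModel_holds hX 1).hodgeLie,
        ∃ Y ∈ (BettiUniverse.hodge exists_isReal_hodgeModel_holds hX 1).hodgeLie, X' * Y - Y * X' = B}) = 3) :
    haveI := BettiUniverse.finite hX 1
    ∃ (B Z : AbelianVariety ℂ) (m : ℕ), B.IsSimple ∧ 0 < B.dim ∧ B.dim ≤ 2 ∧ ¬ IsOfCMType B ∧
      Module.finrank ℚ B.endAlgebra = B.dim ^ 2 ∧ Module.finrank ℚ (Subalgebra.center ℚ B.endAlgebra) = 1 ∧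
      IsOfCMType Z ∧ IsIsogenous X ((B.powSucc m).prod Z) ∧ (m + 1) * B.dim + Z.dim = X.dim ∧
      (Z.dim = 0 ↔ (BettiUniverse.hodge exists_isReal_hodgeModel_holds hX 1).mtRank = 4) ∧
      haveI := BettiUniverse.finite (AbelianVariety.isSmoothProjective_holds (A := Z)) 1
      Module.finrank ℚ (BettiUniverse.hodge exists_isReal_hodgeModel_holds
          (AbelianVariety.isSmoothProjective_holds (A := Z)) 1).hodgeLie =
        Module.finrank ℚ ↥((BettiUniverse.hodge exists_isReal_hodgeModel_holds hX 1).hodgeLie ⊓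
          Subalgebra.toSubmodule (BettiUniverse.hodge exists_isReal_hodgeModel_holds hX 1).endAlg) ∧
      Module.finrank ℚ (BettiUniverse.hodge exists_isReal_hodgeModel_holds
          (AbelianVariety.isSmoothProjective_holds (A := Z)) 1).hodgeLie + 4 =
        (BettiUniverse.hodge exists_isReal_hodgeModel_holds hX 1).mtRank ∧
      (0 < Z.dim → (BettiUniverse.hodge exists_isReal_hodgeModel_holds
          (AbelianVariety.isSmoothProjective_holds (A := Z)) 1).mtRank + 3 =
        (BettiUniverse.hodge exists_isReal_hodgeModel_holds hX 1).mtRank) := by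
  have hcm : ¬ IsOfCMType X := not_isOfCMType_of_finrank_derived_eq_three hX h3
  have hn : X.dim = n := schemeDim_eq_holds hX
  subst hn
  haveI := BettiUniverse.finite hX 1
  have hZsp : ∀ Z : AbelianVariety ℂ, IsSmoothProjective Z.dim Z.X := fun Z => AbelianVariety.isSmoothProjective_holds
  -- `t = dim 𝔷 + 4`
  have ht : (BettiUniverse.hodge exists_isReal_hodgeModel_holds hX 1).mtRank =
      Module.finrank ℚ ↥((BettiUniverse.hodge exists_isReal_hodgeModel_holds hX 1).hodgeLie ⊓
        Subalgebra.toSubmodule (BettiUniverse.hodge exists_isReal_hodgeModel_holds hX 1).endAlg) + 4 := by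
    obtain ⟨h1, -, -, -, -⟩ := mtRank_hodge_one_shape hX h0 hcm
    omega
  obtain ⟨e, M, F, Y, Z, h, i, t, j, hec, hee, he0, he1, hM, hFe, -, hhi, hih, -, -, -, -, hiso, hdimYZ, hZcm, hYcm, hdim,
    hcen, hxy, hx0, h1, h2, hjt, htj, hblk, hZe⟩ := exists_quasiRetraction_splitting_of_finrank_derived_eq_three hX h0 h3
  haveI := BettiUniverse.finite (hZsp Z) 1
  -- the non-CM part `Y ∼ B^{m+1}`
  have hFe' : endAlgebra.of X (End.of (h ≫ i)) = algebraMap ℚ X.endAlgebra (M : ℚ) * e := by rw [hhi]; exact hFe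
  obtain ⟨B, m, hBs, hB0, hB2, hBcm, hfinB, hZB, hYB, hdimY, hx2⟩ :=
    exists_isIsogenous_power_of_corner_data hM hih hec hee hFe' hdim hcen hx0 h1 h2 hYcm
  have hXYZ : IsIsogenous X ((B.powSucc m).prod Z) := by
    have h1' : IsIsogenous (Y ⊞ Z) X := ⟨_, hiso⟩
    have h2' : IsIsogenous (Y ⊞ Z) (Y.prod Z) := ⟨(biprodIsoProd Y Z).hom, isIsogeny_hom_of_iso _⟩
    have h3' : IsIsogenous (Y.prod Z) ((B.powSucc m).prod Z) :=
      (hYB.trans (isIsogenous_biproduct_powSucc B m)).prod (IsIsogenous.refl Z)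
    exact h1'.symm'.trans (h2'.trans h3')
  -- the CM part: `dim Lie Hg(H¹Z) = dim 𝔷`
  set p : Module.End ℚ (bettiCohomology X.X 1) := MulOpposite.unop (bettiRep X e) with hpdef
  have hpA : p ∈ (BettiUniverse.hodge exists_isReal_hodgeModel_holds hX 1).endAlg :=
    Literature.AlgebraicGeometry.ComplexMultiplication.unop_bettiRep_mem_endAlg exists_isReal_hodgeModel_holds
      hodgePQ_independent_of_hodgeModel_holds e
  have hpp : p * p = p := by rw [hpdef, ← MulOpposite.unop_mul, ← map_mul, hee]
  have hp0 : p ≠ 0 := fun hp => he0 (bettiRep_injective (MulOpposite.unop_injective (by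
    rw [← hpdef, hp, map_zero, MulOpposite.unop_zero])))
  have hLie := finrank_hodgeLie_hodge_one_eq_center_of_block hX (hZsp Z) t j hM hjt htj hpA hpp hp0 hblk hZe h3
  -- `dim Z = 0 ↔ e = 1 ↔ dim MT = 4`
  have hZ0 : Z.dim = 0 ↔ (BettiUniverse.hodge exists_isReal_hodgeModel_holds hX 1).mtRank = 4 := by
    rw [← he1]
    have hy : Module.finrank ℚ (LinearMap.ker p) = 2 * Z.dim := by omega
    constructor
    · intro hZ0'
      have hker : LinearMap.ker p = ⊥ := by rw [← Submodule.finrank_eq_zero, hy, hZ0', mul_zero]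
      have hp1 : p = 1 := by
        ext v
        have hv : p (p v - v) = 0 := by rw [map_sub, ← Module.End.mul_apply, hpp, sub_self]
        rw [← LinearMap.mem_ker, hker, Submodule.mem_bot, sub_eq_zero] at hv
        rw [Module.End.one_apply]
        exact hv
      apply bettiRep_injective
      apply MulOpposite.unop_injective
      rw [← hpdef, hp1, map_one, MulOpposite.unop_one]
    · intro he
      have hp1 : p = 1 := by rw [hpdef, he, map_one, MulOpposite.unop_one]
      have h' := hy
      rw [hp1, Module.End.one_eq_id, LinearMap.ker_id, finrank_bot] at h'
      omega
  refine ⟨B, Z, m, hBs, hB0, hB2, hBcm, hfinB, hZB, hZcm, hXYZ, by rw [← hdimY]; exact hdimYZ, hZ0, hLie, by omega, ?_⟩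
  -- `dim MT(H¹Z) = dim Lie Hg(H¹Z) + 1` for `dim Z > 0`
  intro hZpos
  rw [mtRank_hodge_one_eq_finrank_hodgeLie_add_one (hZsp Z) hZpos]
  omega

/-- **The same for `X` NOT of CM type with `dim MT(H¹(X)) ≤ 6`** (then `dim [Lie Hg, Lie Hg] = 3`,
`finrank_derived_eq_three_of_mtRank_le_six`), with the consequences spelled out: the CM part `Z` of `X ∼ B^{m+1} × Z` has
`dim_ℚ Lie Hg(H¹Z) = dim MT(H¹X) − 4 ≤ 2` and, when `dim Z > 0`, `dim MT(H¹Z) = dim MT(H¹X) − 3 ≤ 3`.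
[cite: MoonenZarhin1999LowDim, §2 (2.1)–(2.5) and §3 (3.8)] [cite: MumfordAV1970, §19 Thm. 1, Cor. 1–2 (pp. 173–174)] -/
theorem exists_isIsogenous_powSucc_prod_finrank_hodgeLie_of_mtRank_le_six (hX : IsSmoothProjective n X.X)
    (h0 : 0 < X.dim) (hcm : ¬ IsOfCMType X)
    (h6 : haveI := BettiUniverse.finite hX 1
      (BettiUniverse.hodge exists_isReal_hodgeModel_holds hX 1).mtRank ≤ 6) :
    haveI := BettiUniverse.finite hX 1
    ∃ (B Z : AbelianVariety ℂ) (m : ℕ), B.IsSimple ∧ 0 < B.dim ∧ B.dim ≤ 2 ∧ ¬ IsOfCMType B ∧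
      Module.finrank ℚ B.endAlgebra = B.dim ^ 2 ∧ Module.finrank ℚ (Subalgebra.center ℚ B.endAlgebra) = 1 ∧
      IsOfCMType Z ∧ IsIsogenous X ((B.powSucc m).prod Z) ∧ (m + 1) * B.dim + Z.dim = X.dim ∧
      (Z.dim = 0 ↔ (BettiUniverse.hodge exists_isReal_hodgeModel_holds hX 1).mtRank = 4) ∧
      haveI := BettiUniverse.finite (AbelianVariety.isSmoothProjective_holds (A := Z)) 1
      Module.finrank ℚ (BettiUniverse.hodge exists_isReal_hodgeModel_holds
          (AbelianVariety.isSmoothProjective_holds (A := Z)) 1).hodgeLie + 4 =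
        (BettiUniverse.hodge exists_isReal_hodgeModel_holds hX 1).mtRank ∧
      Module.finrank ℚ (BettiUniverse.hodge exists_isReal_hodgeModel_holds
          (AbelianVariety.isSmoothProjective_holds (A := Z)) 1).hodgeLie ≤ 2 ∧
      (0 < Z.dim → (BettiUniverse.hodge exists_isReal_hodgeModel_holds
          (AbelianVariety.isSmoothProjective_holds (A := Z)) 1).mtRank + 3 =
        (BettiUniverse.hodge exists_isReal_hodgeModel_holds hX 1).mtRank) ∧
      (0 < Z.dim → (BettiUniverse.hodge exists_isReal_hodgeModel_holds
          (AbelianVariety.isSmoothProjective_holds (A := Z)) 1).mtRank ≤ 3) := by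
  haveI := BettiUniverse.finite hX 1
  obtain ⟨B, Z, m, hBs, hB0, hB2, hBcm, hfinB, hZB, hZcm, hXYZ, hdims, hZ0, -, hLie, hmt⟩ :=
    exists_isIsogenous_powSucc_prod_finrank_hodgeLie_of_finrank_derived_eq_three hX h0
      (finrank_derived_eq_three_of_mtRank_le_six hX h0 hcm h6).1
  exact ⟨B, Z, m, hBs, hB0, hB2, hBcm, hfinB, hZB, hZcm, hXYZ, hdims, hZ0, hLie, by omega, hmt, fun hZ => by
    have := hmt hZ; omega⟩

end Summit.HodgeConjecture.CorCM

end
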